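import Summits.HubbardSuperconductivity.HubbardSuperconductivity.Cruxes.SeededBrokenRegimeBoseFermiPinned.SketchIdeator1

open Literature.MathematicalPhysics.QuantumLattice Literature.Probability.LatticeModels
open scoped Matrix ComplexConjugate

/-- S6 closed by the ideator's kernel-checked lemma (statement byte-identical). -/
theorem probe_S6 :
    ∀ (L : ℕ) [NeZero L] (U μ a b : ℝ),
      Matrix.groundEnergy (hubbardTorusWith 2 L 1 U μ
          - (a : ℂ) • (pairField dWaveFormFactor L + (pairField dWaveFormFactor L)ᴴ)
          - (b : ℂ) • (Complex.I • ((pairField dWaveFormFactor L)ᴴ - pairField dWaveFormFactor L)))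
        = Matrix.groundEnergy (dWaveSourceTorus L U μ (Real.sqrt (a ^ 2 + b ^ 2))) :=
  fun L _ U μ a b =>
    Summit.HubbardSuperconductivity.HubbardSuperconductivity.Cruxes.SeededBrokenRegimeBoseFermiPinned.IdeasR1K1.seedRotationIdentity L U μ a b
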